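import Summits.QuantumFields.YangMills.Theorems.BalabanUVNodesN21LowCentreEndAtSUNBlockChartJacobian

/-!
# N21 (NE7c) · THE [LF-II] §1-LETTERS END ON THE EXPONENTIAL `SU(N)` BLOCK CHART, IV: file 10's END AT ONE BLOCK FIBRE LAW OF
# THE RECORD with the Haar Jacobian IN THE REMAINDER — `hdens` DISCHARGED modulo a presentation of the dressed block weight alone

Width seat pub-ymgap-dag-n21-w1 (g2; director-ym №197 ∕ HUMAN RULING D-0149), node N21 = NE7c (single-run shell-weight
bound, NOT PRINTED in [Bałaban 1983–89], NOT proved), lane K3⁷ `SpineGivenEndpointR13SepCoPH` (stmt-QuantumFields-20544,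
`--kind proof --supports … --as helper`).  Twelfth file of the seat's item-1 chain; companion of `…Jacobian` (§1–§3: the
exponential chart's Haar Jacobian `∏_b κ_N·det T_{z_b}` as the cut log-concave weight `1_{B̄_S}·κ_N^{#b}·e^{−Ψ}`, `Ψ` CONVEX on the
window, `Ψ(0) = 0`, `0 ≤ Ψ ≤ W_J := #b·N²·(−2 log sinc S)`; ★ `hdens_of_dressedPresentation`).  Consumes BY NAME: `…Jacobian`,
file 9 ★★★ `slotAntiConcentration_blockChartSU_of_sect1Letters` ∕ `slotAntiConcentration_congr_support`, dag-n21-w2's p600281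
`slotAC_blockFibreLaw_of_chartAC` ∕ `slotAC_termFibreLaw_of_chartAC`, pub-balaban's `chartWeightSU_expJac_ae_eq` ∕ `measurable_chartWeightSU` ∕
`measurable_jacM`.  THEOREMS ONLY: 0 `def`, 0 `sorry`; count-neutral.

WHAT IS PROVED ([textbook] + composition BY NAME).
* §4 ★ `cutChartLawAC_of_sect1Letters_dressed`: the `SlotAntiConcentration ((vol.withDensity f)|A) U` conjunct of dag-n21-w2's
  per-fibre chart package (`A = {U<θ}∩C`, `f` = the density of `…Jacobian` §3's `hdens`) — file 9 ★★★ at `K := K₀ ∩ B̄_S`,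
  `φ := A + Ψ − #b·log κ_N`, `Vt′ := Vt + Ψ`; needs neither `R` nor the reading.
* ★ `chartAC_of_sect1Letters_dressed`: dag-n21-w2's `hchart` ITSELF — `SlotAntiConcentration (vol.withDensity (chartWeightSU b S
  (expJacWeightSU κ_N) · R ∘ expFibreChartSU b c)) (blockReading N u b x ∘ expFibreChartSU b c) θ ρ (3(#b·d_N+1)(1+Q)∕(κ₀(1−ρ)))` —
  at the pure chart level (any lattice, block, centre, exterior), from file 9 ★★★ + §3 of `…Jacobian`; displayed: `hlaw` (window factorisation `blockFibreLawOfDatum₉ … = (blockLaw b).withDensity (windowSU b c S · R)`, dag-n21-w2's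
  letter; `0 < S < π`), the DRESSED presentation ON THE WINDOW `hR : R (expFibreChartSU b c z) = 𝟙_{U<θ}∩C·𝟙_{K₀}·e^{−A}(z)` with
  kept CONVEX cuts `K₀ ∋ 0` and a CONVEX exponent `A` carrying the (1.2) expansion `A v = A 0 + ½Q v + lin v + Vt v` with the
  PRINTED ROWS `Ineq19 (Q v) (Σ_{b′} ‖v b′‖²) γ₀ d M` ∕ `Ineq16 (lin v) …` as hypotheses and `|Vt v| ≤ W_V`; the statistic's
  binders (`hread` on the window, `L`-Lipschitz for the block chart norm, `U 0 ≤ σθ`, `henv`, `hRT`); the odds `hQ` for the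
  UNCUT windowed chart law `vol.withDensity (chartWeightSU b S (expJacWeightSU κ_N) · 𝟙_{K₀} e^{−A})`; ONE clause with the
  Jacobian letter added to the remainder's bound, `16·(W + W_V + W_J)·d·(100M)^{d+1}·(d_N·L²) ≤ γ₀(θ(1−ρ−σ))²`.  Inside:
  `K := K₀ ∩ B̄_S`, `φ := A + Ψ − #b·log κ_N`, `Vt′ := Vt + Ψ`.
* ★★ `fibreAC_of_sect1Letters_expChartSU_dressed` ∕ `termFibreAC_of_sect1Letters_expChartSU_dressed`: ★ through p600281's
  `slotAC_blockFibreLaw_of_chartAC` ∕ `slotAC_termFibreLaw_of_chartAC` with the window factorisation `hlaw` ⇒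
  `SlotAntiConcentration (blockFibreLawOfDatum₉ … t a b x) (blockReading N u b x) θ ρ (…)` (resp. `termFibreLawOfDatum₉ … t s b x`) —
  the per-fibre `hfib` input of dag-n21-d's ★★★★ ∕ FILE 7 ∕ p598391, with file 10's `hdens` DISCHARGED modulo `hR`.

HONEST FRAMING.  [textbook] + composition BY NAME; the Haar Jacobian of the exponential chart is DISCHARGED (pub-balaban's
theorems, credited; nothing retyped); the located letters that REMAIN hypotheses are `hlaw`, the dressed presentation `hR`
(convexity of the (1.2) exponent on the chart — desk (t4) — with its rows' identification with the N21 slot's block action),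
and the statistic's binders; nothing of Bałaban's asserted; NE7c NOT PRINTED ∕ NOT proved; N21 NOT discharged; K3⁷ NOT
claimed; counts unmoved (typed 28∕28 · discharged 5∕27); never a count claim; one finite 𝕋⁴ at fixed ε — R4 would close only the
conditional finite-𝕋⁴ rung `BalabanLadder.UV`, NOT the Yang–Mills mass gap (Clay); nothing about ℝ⁴ ∕ OS.
-/

set_option autoImplicit false

noncomputable section

open MeasureTheory Set Function Finset Metric
open scoped ENNReal BigOperators

namespace Summit.QuantumFields.YangMills.Theorems.N21LowCentreEndAtSUNBlockChartJacobianEnd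

open Literature.MathematicalPhysics.QuantumFieldTheory.Balaban1983to89
open Literature.MathematicalPhysics.QuantumFieldTheory.Balaban1983to89.T4Continuum
open Literature.MathematicalPhysics.QuantumFieldTheory.Balaban1983to89.Node00 hiding dimSU
open Literature.MathematicalPhysics.QuantumFieldTheory.Balaban1983to89.T4ShellMeasure (SlotAntiConcentration)
open Literature.MathematicalPhysics.QuantumFieldTheory.Balaban1983to89.T4ShellMeasureDet (blockLaw)
open Literature.MathematicalPhysics.QuantumFieldTheory.Balaban1983to89.B16Sect1Wilson (Ineq16 Ineq19)
open Summit.QuantumFields.BalabanUV.T4Continuum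
open Summit.QuantumFields.BalabanUV.T4Continuum.ShellMeasureExpChartSUN
  (SUN ChartSU BlockChartSU dimSU expFibreChartSU chartWeightSU measurable_chartWeightSU)
open Summit.QuantumFields.BalabanUV.T4Continuum.ShellMeasureScalingSUN (windowSU)
open Summit.QuantumFields.BalabanUV.T4Continuum.ShellMeasureExpJacobianSUN (expJacWeightSU)
open Summit.QuantumFields.BalabanUV.T4Continuum.ShellMeasureExpHaarAreaSUN (jacM measurable_jacM kappaSU kappaSU_ne_top kappaSU_ne_zero)
open Summit.QuantumFields.BalabanUV.T4Continuum.ShellMeasureExpDuhamelSUN (duhT)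
open Summit.QuantumFields.YangMills.Theorems.N21ShellSplitOfRecord13CoPH (blockReading blockFibreLawOfDatum₉ termFibreLawOfDatum₉)
open Summit.QuantumFields.YangMills.Theorems.N21DilationRoadAtRecord13CoPH
  (measurable_blockReading slotAC_blockFibreLaw_of_chartAC slotAC_termFibreLaw_of_chartAC)
open Summit.QuantumFields.YangMills.Theorems.N21LowCentreEndAtSUNBlockChart
  (slotAntiConcentration_congr_support slotAntiConcentration_blockChartSU_of_sect1Letters)
open Summit.QuantumFields.YangMills.Theorems.N21LowCentreEndAtSUNBlockChartJacobian
  (convexOn_blockNegLogDet blockNegLogDet_nonneg blockNegLogDet_zero blockNegLogDet_le chartWeightSU_jacM_eq_indicator_exp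
    chartWeightSU_expJac_ae_eq_indicator_exp hdens_of_dressedPresentation)

/-! ## §4  ★ dag-n21-w2's `hchart` from the dressed presentation; ★★ the END at the record's block ∕ term fibre laws -/

section Chart

variable {N : ℕ} [NeZero N] {P : Params} {j : ℕ}

/-- ★ **THE CUT CHART LAW's (M1), THE HAAR JACOBIAN IN THE EXPONENT** — the `SlotAntiConcentration ((vol.withDensity f)|A) U`
conjunct of dag-n21-w2's per-fibre chart package, with `A = {U<θ} ∩ C` and `f = 𝟙_{K₀ ∩ B̄_S}·e^{−(A + Ψ − #b log κ_N)}` (the density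
of `…Jacobian` §3's `hdens`): file 9 ★★★ at `K := K₀ ∩ B̄_S`, `φ := A + Ψ − #b·log κ_N`, `Vt′ := Vt + Ψ`.  Displayed: `2 ≤ N`,
`b` nonempty, `0 < S < π`; kept CONVEX cuts `K₀ ∋ 0`, CONVEX `A` with the (1.2) expansion, the PRINTED ROWS `Ineq19`∕`Ineq16` as
hypotheses, `|Vt| ≤ W_V`; the statistic `L`-Lipschitz for the block chart norm with `U 0 ≤ σθ`, `henv`, `hRT`; the odds `hQ` for the
UNCUT windowed chart law `vol.withDensity (chartWeightSU b S (expJacWeightSU κ_N) · 𝟙_{K₀} e^{−A})`; ONE clause with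
`W_J = #b·N²·(−2 log sinc S)` added to the remainder's bound.  Needs neither the block weight `R` nor the statistic's reading.
[bookkeeping] -/
theorem cutChartLawAC_of_sect1Letters_dressed (hN : 2 ≤ N) (b : Finset (PBond P j)) (hb : b.Nonempty)
    {S : ℝ} (hS : 0 < S) (hSπ : S < Real.pi)
    (K₀ : Set (BlockChartSU N b)) (A Qf lin Vt : BlockChartSU N b → ℝ)
    (hAm : Measurable fun z : BlockChartSU N b => K₀.indicator (fun w => ENNReal.ofReal (Real.exp (-A w))) z)
    {U : BlockChartSU N b → ℝ} (hUm : Measurable U)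
    {C Env : Set (BlockChartSU N b)} (hC : MeasurableSet C) (hEnv : MeasurableSet Env)
    {θ ρ σ κ₀ Q L γ₀ M B₃ M₀ A₀ p₀g Rk WV : ℝ} {d : ℕ}
    (hθ : 0 < θ) (hρ0 : 0 < ρ) (hρ1 : ρ < 1) (hρσ : ρ + σ ≤ 1) (hκ : 0 < κ₀) (hQ0 : 0 ≤ Q) (hL : 0 < L)
    (hd : 1 ≤ d) (hM : 0 < M) (hγ₀ : 0 < γ₀)
    (hW : 0 ≤ 3 * B₃ * M₀ * A₀ ^ 2 * p₀g ^ 2 * Real.exp (-Rk) * (100 * M) ^ 4 + WV)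
    (hK₀ : Convex ℝ K₀) (hA : ConvexOn ℝ K₀ A) (h0K₀ : (0 : BlockChartSU N b) ∈ K₀)
    (hexp : ∀ v ∈ K₀, A v = A 0 + 1 / 2 * Qf v + lin v + Vt v)
    (h19 : ∀ v ∈ K₀, Ineq19 (Qf v) (∑ i, ‖v i‖ ^ 2) γ₀ d M)
    (h16 : ∀ v ∈ K₀, Ineq16 (lin v) B₃ M₀ A₀ p₀g Rk M)
    (hV : ∀ v ∈ K₀, |Vt v| ≤ WV)
    (hUL : ∀ z z' : BlockChartSU N b, U z - U z' ≤ L * ‖z - z'‖)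
    (hUc : U 0 ≤ σ * θ)
    (hclause : 16 * (3 * B₃ * M₀ * A₀ ^ 2 * p₀g ^ 2 * Real.exp (-Rk) * (100 * M) ^ 4 +
        (WV + b.card * ((N * N : ℕ) * (-2 * Real.log (Real.sinc S))))) * d
      * (100 * M) ^ (d + 1) * (dimSU N * L ^ 2) ≤ γ₀ * (θ * (1 - ρ - σ)) ^ 2)
    (henv : ∀ l ∈ Icc (1 - 1 / ((b.card : ℝ) * dimSU N + 1)) 1, ∀ z : BlockChartSU N b,
      θ * (1 - ρ) ≤ U z → U z < θ → z ∈ C → l • z ∈ Env)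
    (hRT : ∀ z : BlockChartSU N b, θ * (1 - ρ) ≤ U z → U z < θ → z ∈ C → ∀ s' : ℝ, 1 ≤ s' →
      θ * (1 - ρ) ≤ U (s' • z) → U (s' • z) < θ → s' • z ∈ C → U z + κ₀ * (θ * (1 - ρ)) * (s' - 1) ≤ U (s' • z))
    (hQ : ((volume : Measure (BlockChartSU N b)).withDensity fun z =>
        chartWeightSU b S (expJacWeightSU (kappaSU N)) z * K₀.indicator (fun w => ENNReal.ofReal (Real.exp (-A w))) z)
          (Env \ ({z | U z < θ} ∩ C))
      ≤ ENNReal.ofReal Q * ((volume : Measure (BlockChartSU N b)).withDensity fun z =>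
        chartWeightSU b S (expJacWeightSU (kappaSU N)) z * K₀.indicator (fun w => ENNReal.ofReal (Real.exp (-A w))) z)
          ({z | U z < θ} ∩ C)) :
    SlotAntiConcentration
      (((volume : Measure (BlockChartSU N b)).withDensity fun z => (K₀ ∩ closedBall (0 : BlockChartSU N b) S).indicator
        (fun w => ENNReal.ofReal (Real.exp (-(A w +
          (∑ i, -Real.log (LinearMap.det (duhT (w i) : ChartSU N →ₗ[ℝ] ChartSU N))) -
            b.card * Real.log (kappaSU N).toReal)))) z).restrict ({z | U z < θ} ∩ C))
      U θ ρ (3 * ((b.card : ℝ) * dimSU N + 1) * (1 + Q) / (κ₀ * (1 - ρ))) := by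
  -- abbreviations: the Jacobian letter `Ψ`, its bound `W_J`, the new cuts `K` and exponent `φ`
  set Ψ : BlockChartSU N b → ℝ := fun w => ∑ i, -Real.log (LinearMap.det (duhT (w i) : ChartSU N →ₗ[ℝ] ChartSU N))
    with hΨ_def
  set WJ : ℝ := b.card * ((N * N : ℕ) * (-2 * Real.log (Real.sinc S))) with hWJ_def
  set K : Set (BlockChartSU N b) := K₀ ∩ closedBall (0 : BlockChartSU N b) S with hK_def
  set φ : BlockChartSU N b → ℝ := fun w => A w + Ψ w - b.card * Real.log (kappaSU N).toReal with hφ_def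
  have hS0 : 0 ≤ S := hS.le
  have hΨ0 : Ψ 0 = 0 := blockNegLogDet_zero (N := N) b
  have hΨnn : ∀ w, 0 ≤ Ψ w := fun w => blockNegLogDet_nonneg (N := N) b w
  have hΨle : ∀ w ∈ closedBall (0 : BlockChartSU N b) S, Ψ w ≤ WJ := fun w hw => blockNegLogDet_le (N := N) b hSπ hw
  have hWJ0 : 0 ≤ WJ := (hΨnn 0).trans (hΨle 0 (mem_closedBall_self hS0))
  -- the new density, everywhere: `𝟙_K e^{−φ} = (1_{B̄_S}·κ^{#b}·e^{−Ψ}) · 𝟙_{K₀} e^{−A}`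
  have hκr : ENNReal.ofReal (kappaSU N).toReal = kappaSU N := ENNReal.ofReal_toReal kappaSU_ne_top
  have hκpos : 0 < (kappaSU N).toReal := ENNReal.toReal_pos kappaSU_ne_zero kappaSU_ne_top
  have hκpow : kappaSU N ^ b.card = ENNReal.ofReal ((kappaSU N).toReal ^ b.card) := by
    rw [ENNReal.ofReal_pow hκpos.le, hκr]
  have hgK : (fun z : BlockChartSU N b => K.indicator (fun w => ENNReal.ofReal (Real.exp (-φ w))) z) =
      fun z => (closedBall (0 : BlockChartSU N b) S).indicator
          (fun w => kappaSU N ^ b.card * ENNReal.ofReal (Real.exp (-Ψ w))) z *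
        K₀.indicator (fun w => ENNReal.ofReal (Real.exp (-A w))) z := by
    funext z
    by_cases hzS : z ∈ closedBall (0 : BlockChartSU N b) S
    · by_cases hzK : z ∈ K₀
      · rw [indicator_of_mem (mem_inter hzK hzS), indicator_of_mem hzS, indicator_of_mem hzK, hκpow,
          ← ENNReal.ofReal_mul (pow_nonneg hκpos.le _), ← ENNReal.ofReal_mul (by positivity)]
        congr 1
        rw [← Real.exp_log (pow_pos hκpos _), ← Real.exp_add, ← Real.exp_add, Real.log_pow]
        congr 1
        simp only [hφ_def]
        ring
      · rw [indicator_of_notMem (fun h => hzK h.1), indicator_of_notMem hzK, mul_zero]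
    · rw [indicator_of_notMem (fun h => hzS h.2), indicator_of_notMem hzS, zero_mul]
  have hgKm : Measurable fun z : BlockChartSU N b => K.indicator (fun w => ENNReal.ofReal (Real.exp (-φ w))) z := by
    rw [hgK]
    refine Measurable.mul ?_ hAm
    have heq : ((closedBall (0 : BlockChartSU N b) S).indicator
        fun w => kappaSU N ^ b.card * ENNReal.ofReal (Real.exp (-Ψ w))) =
        chartWeightSU b S (fun v => kappaSU N * jacM v) :=
      funext fun z => (chartWeightSU_jacM_eq_indicator_exp (N := N) b hSπ.le z).symm
    rw [heq]
    exact measurable_chartWeightSU b S (measurable_const.mul measurable_jacM)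
  -- the uncut new law IS the uncut windowed chart law of record (a.e. Jacobian swap)
  have hlawK : (volume : Measure (BlockChartSU N b)).withDensity
      (fun z => K.indicator (fun w => ENNReal.ofReal (Real.exp (-φ w))) z) =
      (volume : Measure (BlockChartSU N b)).withDensity fun z =>
        chartWeightSU b S (expJacWeightSU (kappaSU N)) z * K₀.indicator (fun w => ENNReal.ofReal (Real.exp (-A w))) z := by
    rw [hgK]
    refine withDensity_congr_ae ?_
    filter_upwards [chartWeightSU_expJac_ae_eq_indicator_exp (N := N) b hSπ.le] with z hz
    show _ = chartWeightSU b S (expJacWeightSU (kappaSU N)) z * _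
    rw [hz]
  -- file 9 ★★★ with the new frame
  refine slotAntiConcentration_blockChartSU_of_sect1Letters hN b hb K φ Qf lin (fun w => Vt w + Ψ w) hgKm hUm hC hEnv
    (WV := WV + WJ) hθ hρ0 hρ1 hρσ hκ hQ0 hL hd hM hγ₀ (by linarith) (hK₀.inter (convex_closedBall _ _)) ?_
    (mem_inter h0K₀ (mem_closedBall_self hS0)) ?_ (fun v hv => h19 v hv.1) (fun v hv => h16 v hv.1) ?_ hUL hUc hclause
    henv hRT (by rw [hlawK]; exact hQ)
  · -- hφ: `A + Ψ − #b·log κ_N` is convex on `K`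
    have hKc : Convex ℝ K := hK₀.inter (convex_closedBall _ _)
    have h1 : ConvexOn ℝ K A := hA.subset inter_subset_left hKc
    have h2 : ConvexOn ℝ K Ψ := (convexOn_blockNegLogDet (N := N) b hSπ.le).subset inter_subset_right hKc
    have h3 := h1.add h2
    refine ⟨hKc, fun x' hx y' hy a' c' ha hc hac => ?_⟩
    have h := h3.2 hx hy ha hc hac
    simp only [hφ_def, Pi.add_apply, smul_eq_mul] at h ⊢
    have hac' : a' * (↑b.card * Real.log (kappaSU N).toReal) + c' * (↑b.card * Real.log (kappaSU N).toReal) =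
        ↑b.card * Real.log (kappaSU N).toReal := by
      rw [← add_mul, hac, one_mul]
    linarith
  · -- hexp on `K`: `φ v − φ 0 = A v − A 0 + Ψ v`
    intro v hv
    simp only [hφ_def]
    rw [hexp v hv.1, hΨ0]
    ring
  · -- hV: `|Vt v + Ψ v| ≤ W_V + W_J` on `K`
    intro v hv
    have h1 := hV v hv.1
    have h2 := hΨle v hv.2
    have h3 := hΨnn v
    show |Vt v + Ψ v| ≤ WV + WJ
    rw [abs_le] at h1 ⊢
    constructor <;> linarith

/-- ★ **JUNCTION №3's `hchart` FROM THE DRESSED PRESENTATION — THE HAAR JACOBIAN IN THE REMAINDER.**  Pure chart level (any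
lattice, nonempty block `b`, centre `c`, block weight `R`, statistic `u`, exterior `x`; `2 ≤ N`, `0 < S < π`): the cut chart
law's (M1) above, `…Jacobian` §3's `hdens` from the DRESSED presentation `hR` on the window, and the reading identity `hread` on
the window ⇒ (M1) for the chart law of record and the statistic read in the chart — dag-n21-w2's `hchart` verbatim, constant
`3(#b·d_N+1)(1+Q)∕(κ₀(1−ρ))`. [bookkeeping] -/
theorem chartAC_of_sect1Letters_dressed (hN : 2 ≤ N) (b : Finset (PBond P j)) (hb : b.Nonempty)
    {S : ℝ} (hS : 0 < S) (hSπ : S < Real.pi) (c : GaugeField P j (SU N)) (R : (↥b → SU N) → ℝ≥0∞)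
    (u : GaugeField P j (SU N) → ℝ) (x : GaugeField P j (SU N))
    (K₀ : Set (BlockChartSU N b)) (A Qf lin Vt : BlockChartSU N b → ℝ)
    (hAm : Measurable fun z : BlockChartSU N b => K₀.indicator (fun w => ENNReal.ofReal (Real.exp (-A w))) z)
    {U : BlockChartSU N b → ℝ} (hUm : Measurable U)
    {C Env : Set (BlockChartSU N b)} (hC : MeasurableSet C) (hEnv : MeasurableSet Env)
    {θ ρ σ κ₀ Q L γ₀ M B₃ M₀ A₀ p₀g Rk WV : ℝ} {d : ℕ}
    (hθ : 0 < θ) (hρ0 : 0 < ρ) (hρ1 : ρ < 1) (hρσ : ρ + σ ≤ 1) (hκ : 0 < κ₀) (hQ0 : 0 ≤ Q) (hL : 0 < L)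
    (hd : 1 ≤ d) (hM : 0 < M) (hγ₀ : 0 < γ₀)
    (hW : 0 ≤ 3 * B₃ * M₀ * A₀ ^ 2 * p₀g ^ 2 * Real.exp (-Rk) * (100 * M) ^ 4 + WV)
    (hK₀ : Convex ℝ K₀) (hA : ConvexOn ℝ K₀ A) (h0K₀ : (0 : BlockChartSU N b) ∈ K₀)
    (hexp : ∀ v ∈ K₀, A v = A 0 + 1 / 2 * Qf v + lin v + Vt v)
    (h19 : ∀ v ∈ K₀, Ineq19 (Qf v) (∑ i, ‖v i‖ ^ 2) γ₀ d M)
    (h16 : ∀ v ∈ K₀, Ineq16 (lin v) B₃ M₀ A₀ p₀g Rk M)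
    (hV : ∀ v ∈ K₀, |Vt v| ≤ WV)
    (hUL : ∀ z z' : BlockChartSU N b, U z - U z' ≤ L * ‖z - z'‖)
    (hUc : U 0 ≤ σ * θ)
    (hclause : 16 * (3 * B₃ * M₀ * A₀ ^ 2 * p₀g ^ 2 * Real.exp (-Rk) * (100 * M) ^ 4 +
        (WV + b.card * ((N * N : ℕ) * (-2 * Real.log (Real.sinc S))))) * d
      * (100 * M) ^ (d + 1) * (dimSU N * L ^ 2) ≤ γ₀ * (θ * (1 - ρ - σ)) ^ 2)
    (henv : ∀ l ∈ Icc (1 - 1 / ((b.card : ℝ) * dimSU N + 1)) 1, ∀ z : BlockChartSU N b,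
      θ * (1 - ρ) ≤ U z → U z < θ → z ∈ C → l • z ∈ Env)
    (hRT : ∀ z : BlockChartSU N b, θ * (1 - ρ) ≤ U z → U z < θ → z ∈ C → ∀ s' : ℝ, 1 ≤ s' →
      θ * (1 - ρ) ≤ U (s' • z) → U (s' • z) < θ → s' • z ∈ C → U z + κ₀ * (θ * (1 - ρ)) * (s' - 1) ≤ U (s' • z))
    (hQ : ((volume : Measure (BlockChartSU N b)).withDensity fun z =>
        chartWeightSU b S (expJacWeightSU (kappaSU N)) z * K₀.indicator (fun w => ENNReal.ofReal (Real.exp (-A w))) z)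
          (Env \ ({z | U z < θ} ∩ C))
      ≤ ENNReal.ofReal Q * ((volume : Measure (BlockChartSU N b)).withDensity fun z =>
        chartWeightSU b S (expJacWeightSU (kappaSU N)) z * K₀.indicator (fun w => ENNReal.ofReal (Real.exp (-A w))) z)
          ({z | U z < θ} ∩ C))
    (hR : ∀ z ∈ closedBall (0 : BlockChartSU N b) S, R (expFibreChartSU b c z) =
      ({z | U z < θ} ∩ C).indicator (fun z' => K₀.indicator (fun w => ENNReal.ofReal (Real.exp (-A w))) z') z)
    (hread : ∀ z ∈ closedBall (0 : BlockChartSU N b) S, blockReading N u b x (expFibreChartSU b c z) = U z) :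
    SlotAntiConcentration ((volume : Measure (BlockChartSU N b)).withDensity fun z =>
        chartWeightSU b S (expJacWeightSU (kappaSU N)) z * R (expFibreChartSU b c z))
      (blockReading N u b x ∘ expFibreChartSU b c) θ ρ (3 * ((b.card : ℝ) * dimSU N + 1) * (1 + Q) / (κ₀ * (1 - ρ))) := by
  have h1 := cutChartLawAC_of_sect1Letters_dressed hN b hb hS hSπ K₀ A Qf lin Vt hAm hUm hC hEnv hθ hρ0 hρ1 hρσ hκ hQ0 hL hd hM hγ₀ hW
      hK₀ hA h0K₀ hexp h19 h16 hV hUL hUc hclause henv hRT hQ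
  -- from the cut law of the new frame to the chart law of record, then to the block reading on the window
  have hA' : MeasurableSet ({z | U z < θ} ∩ C) := (measurableSet_lt hUm measurable_const).inter hC
  rw [restrict_withDensity hA', ← withDensity_indicator hA',
    ← withDensity_congr_ae (hdens_of_dressedPresentation (N := N) b hSπ.le c R U C K₀ A θ hR)] at h1
  have hform : (fun z : BlockChartSU N b =>
      chartWeightSU b S (expJacWeightSU (kappaSU N)) z * R (expFibreChartSU b c z)) =
      (closedBall (0 : BlockChartSU N b) S).indicator
        fun z => (∏ i, expJacWeightSU (kappaSU N) (z i)) * R (expFibreChartSU b c z) := by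
    funext z
    show (closedBall (0 : BlockChartSU N b) S).indicator (fun z' => ∏ i, expJacWeightSU (kappaSU N) (z' i)) z *
        R (expFibreChartSU b c z) = _
    exact (Set.indicator_mul_left (closedBall (0 : BlockChartSU N b) S)
      (fun z' => ∏ i, expJacWeightSU (kappaSU N) (z' i)) fun z' => R (expFibreChartSU b c z')).symm
  rw [hform] at h1 ⊢
  exact slotAntiConcentration_congr_support volume measurableSet_closedBall _ (fun z hz => (hread z hz).symm) h1

end Chart

section End

variable (F : T4Family) (N : ℕ) [NeZero N] (ϑ : Stage9Params F N) (Dt : FiniteEpsData F (SU N)) (g₀ : ℕ → ℝ)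
  (os : List (ULoop F)) (p : B12.RunParams) (g : ℕ → ℝ) (k : ℕ)

/-- ★★ **THE [LF-II] §1-LETTERS END AT ONE BLOCK FIBRE LAW OF THE RECORD, THE HAAR JACOBIAN IN THE REMAINDER.**  ★ through
dag-n21-w2's `slotAC_blockFibreLaw_of_chartAC` with the window factorisation `hlaw`: file 10 ★★★ with its density presentation
`hdens` DISCHARGED modulo the dressed presentation `hR` ⇒
`SlotAntiConcentration (blockFibreLawOfDatum₉ … t a b x) (blockReading N u b x) θ ρ (3(#b·d_N+1)(1+Q)∕(κ₀(1−ρ)))`.  LOCATED junction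
(`hlaw`, `hR`, the rows' identification with the N21 slot's block action are hypotheses). [bookkeeping] -/
theorem fibreAC_of_sect1Letters_expChartSU_dressed (hN : 2 ≤ N) (t : ℝ)
    (a : ↥(cubeIndices (F.P p.K) (cubeSide (F.P p.K).L ϑ.ν.M₂ (RkOfRecord (F.P p.K).L ϑ.ν.r (g k)) k)))
    (b : Finset (PBond (F.P p.K) k)) (hb : b.Nonempty) (x : GaugeField (F.P p.K) k (SU N))
    {S : ℝ} (hS : 0 < S) (hSπ : S < Real.pi) (c : GaugeField (F.P p.K) k (SU N))
    {R : (↥b → SU N) → ℝ≥0∞} (hRm : Measurable R)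
    (hlaw : blockFibreLawOfDatum₉ F N ϑ Dt g₀ os p g k t a b x = (blockLaw b).withDensity fun y => windowSU b c S y * R y)
    {u : GaugeField (F.P p.K) k (SU N) → ℝ} (hu : Measurable u)
    (K₀ : Set (BlockChartSU N b)) (A Qf lin Vt : BlockChartSU N b → ℝ)
    (hAm : Measurable fun z : BlockChartSU N b => K₀.indicator (fun w => ENNReal.ofReal (Real.exp (-A w))) z)
    {U : BlockChartSU N b → ℝ} (hUm : Measurable U)
    {C Env : Set (BlockChartSU N b)} (hC : MeasurableSet C) (hEnv : MeasurableSet Env)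
    {θ ρ σ κ₀ Q L γ₀ M B₃ M₀ A₀ p₀g Rk WV : ℝ} {d : ℕ}
    (hθ : 0 < θ) (hρ0 : 0 < ρ) (hρ1 : ρ < 1) (hρσ : ρ + σ ≤ 1) (hκ : 0 < κ₀) (hQ0 : 0 ≤ Q) (hL : 0 < L)
    (hd : 1 ≤ d) (hM : 0 < M) (hγ₀ : 0 < γ₀)
    (hW : 0 ≤ 3 * B₃ * M₀ * A₀ ^ 2 * p₀g ^ 2 * Real.exp (-Rk) * (100 * M) ^ 4 + WV)
    (hK₀ : Convex ℝ K₀) (hA : ConvexOn ℝ K₀ A) (h0K₀ : (0 : BlockChartSU N b) ∈ K₀)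
    (hexp : ∀ v ∈ K₀, A v = A 0 + 1 / 2 * Qf v + lin v + Vt v)
    (h19 : ∀ v ∈ K₀, Ineq19 (Qf v) (∑ i, ‖v i‖ ^ 2) γ₀ d M)
    (h16 : ∀ v ∈ K₀, Ineq16 (lin v) B₃ M₀ A₀ p₀g Rk M)
    (hV : ∀ v ∈ K₀, |Vt v| ≤ WV)
    (hR : ∀ z ∈ closedBall (0 : BlockChartSU N b) S, R (expFibreChartSU b c z) =
      ({z | U z < θ} ∩ C).indicator (fun z' => K₀.indicator (fun w => ENNReal.ofReal (Real.exp (-A w))) z') z)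
    -- the statistic
    (hread : ∀ z ∈ closedBall (0 : BlockChartSU N b) S, blockReading N u b x (expFibreChartSU b c z) = U z)
    (hUL : ∀ z z' : BlockChartSU N b, U z - U z' ≤ L * ‖z - z'‖)
    (hUc : U 0 ≤ σ * θ)
    (hclause : 16 * (3 * B₃ * M₀ * A₀ ^ 2 * p₀g ^ 2 * Real.exp (-Rk) * (100 * M) ^ 4 +
        (WV + b.card * ((N * N : ℕ) * (-2 * Real.log (Real.sinc S))))) * d
      * (100 * M) ^ (d + 1) * (dimSU N * L ^ 2) ≤ γ₀ * (θ * (1 - ρ - σ)) ^ 2)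
    (henv : ∀ l ∈ Icc (1 - 1 / ((b.card : ℝ) * dimSU N + 1)) 1, ∀ z : BlockChartSU N b,
      θ * (1 - ρ) ≤ U z → U z < θ → z ∈ C → l • z ∈ Env)
    (hRT : ∀ z : BlockChartSU N b, θ * (1 - ρ) ≤ U z → U z < θ → z ∈ C → ∀ s' : ℝ, 1 ≤ s' →
      θ * (1 - ρ) ≤ U (s' • z) → U (s' • z) < θ → s' • z ∈ C → U z + κ₀ * (θ * (1 - ρ)) * (s' - 1) ≤ U (s' • z))
    (hQ : ((volume : Measure (BlockChartSU N b)).withDensity fun z =>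
        chartWeightSU b S (expJacWeightSU (kappaSU N)) z * K₀.indicator (fun w => ENNReal.ofReal (Real.exp (-A w))) z)
          (Env \ ({z | U z < θ} ∩ C))
      ≤ ENNReal.ofReal Q * ((volume : Measure (BlockChartSU N b)).withDensity fun z =>
        chartWeightSU b S (expJacWeightSU (kappaSU N)) z * K₀.indicator (fun w => ENNReal.ofReal (Real.exp (-A w))) z)
          ({z | U z < θ} ∩ C)) :
    SlotAntiConcentration (blockFibreLawOfDatum₉ F N ϑ Dt g₀ os p g k t a b x) (blockReading N u b x) θ ρ
      (3 * ((b.card : ℝ) * dimSU N + 1) * (1 + Q) / (κ₀ * (1 - ρ))) :=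
  slotAC_blockFibreLaw_of_chartAC F N ϑ Dt g₀ os p g k t a b x hS.le hSπ.le c hRm hlaw (measurable_blockReading hu b x)
    (chartAC_of_sect1Letters_dressed hN b hb hS hSπ c R u x K₀ A Qf lin Vt hAm hUm hC hEnv hθ hρ0 hρ1 hρσ hκ hQ0 hL hd hM hγ₀ hW
      hK₀ hA h0K₀ hexp h19 h16 hV hUL hUc hclause henv hRT hQ hR hread)

/-- ★★ **THE SAME AT ONE TERM's FIBRE LAW** `termFibreLawOfDatum₉ … t s b x` (dag-n21-d's FILE 7 ∕ Defs v1.2), through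
`slotAC_termFibreLaw_of_chartAC`.  LOCATED junction. [bookkeeping] -/
theorem termFibreAC_of_sect1Letters_expChartSU_dressed (hN : 2 ≤ N) (t : ℝ) (s : SeqOfRecord F ϑ.ν ϑ.τ9.M g p.K k)
    (b : Finset (PBond (F.P p.K) k)) (hb : b.Nonempty) (x : GaugeField (F.P p.K) k (SU N))
    {S : ℝ} (hS : 0 < S) (hSπ : S < Real.pi) (c : GaugeField (F.P p.K) k (SU N))
    {R : (↥b → SU N) → ℝ≥0∞} (hRm : Measurable R)
    (hlaw : termFibreLawOfDatum₉ F N ϑ Dt g₀ os p g k t s b x = (blockLaw b).withDensity fun y => windowSU b c S y * R y)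
    {u : GaugeField (F.P p.K) k (SU N) → ℝ} (hu : Measurable u)
    (K₀ : Set (BlockChartSU N b)) (A Qf lin Vt : BlockChartSU N b → ℝ)
    (hAm : Measurable fun z : BlockChartSU N b => K₀.indicator (fun w => ENNReal.ofReal (Real.exp (-A w))) z)
    {U : BlockChartSU N b → ℝ} (hUm : Measurable U)
    {C Env : Set (BlockChartSU N b)} (hC : MeasurableSet C) (hEnv : MeasurableSet Env)
    {θ ρ σ κ₀ Q L γ₀ M B₃ M₀ A₀ p₀g Rk WV : ℝ} {d : ℕ}
    (hθ : 0 < θ) (hρ0 : 0 < ρ) (hρ1 : ρ < 1) (hρσ : ρ + σ ≤ 1) (hκ : 0 < κ₀) (hQ0 : 0 ≤ Q) (hL : 0 < L)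
    (hd : 1 ≤ d) (hM : 0 < M) (hγ₀ : 0 < γ₀)
    (hW : 0 ≤ 3 * B₃ * M₀ * A₀ ^ 2 * p₀g ^ 2 * Real.exp (-Rk) * (100 * M) ^ 4 + WV)
    (hK₀ : Convex ℝ K₀) (hA : ConvexOn ℝ K₀ A) (h0K₀ : (0 : BlockChartSU N b) ∈ K₀)
    (hexp : ∀ v ∈ K₀, A v = A 0 + 1 / 2 * Qf v + lin v + Vt v)
    (h19 : ∀ v ∈ K₀, Ineq19 (Qf v) (∑ i, ‖v i‖ ^ 2) γ₀ d M)
    (h16 : ∀ v ∈ K₀, Ineq16 (lin v) B₃ M₀ A₀ p₀g Rk M)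
    (hV : ∀ v ∈ K₀, |Vt v| ≤ WV)
    (hR : ∀ z ∈ closedBall (0 : BlockChartSU N b) S, R (expFibreChartSU b c z) =
      ({z | U z < θ} ∩ C).indicator (fun z' => K₀.indicator (fun w => ENNReal.ofReal (Real.exp (-A w))) z') z)
    -- the statistic
    (hread : ∀ z ∈ closedBall (0 : BlockChartSU N b) S, blockReading N u b x (expFibreChartSU b c z) = U z)
    (hUL : ∀ z z' : BlockChartSU N b, U z - U z' ≤ L * ‖z - z'‖)
    (hUc : U 0 ≤ σ * θ)
    (hclause : 16 * (3 * B₃ * M₀ * A₀ ^ 2 * p₀g ^ 2 * Real.exp (-Rk) * (100 * M) ^ 4 +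
        (WV + b.card * ((N * N : ℕ) * (-2 * Real.log (Real.sinc S))))) * d
      * (100 * M) ^ (d + 1) * (dimSU N * L ^ 2) ≤ γ₀ * (θ * (1 - ρ - σ)) ^ 2)
    (henv : ∀ l ∈ Icc (1 - 1 / ((b.card : ℝ) * dimSU N + 1)) 1, ∀ z : BlockChartSU N b,
      θ * (1 - ρ) ≤ U z → U z < θ → z ∈ C → l • z ∈ Env)
    (hRT : ∀ z : BlockChartSU N b, θ * (1 - ρ) ≤ U z → U z < θ → z ∈ C → ∀ s' : ℝ, 1 ≤ s' →
      θ * (1 - ρ) ≤ U (s' • z) → U (s' • z) < θ → s' • z ∈ C → U z + κ₀ * (θ * (1 - ρ)) * (s' - 1) ≤ U (s' • z))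
    (hQ : ((volume : Measure (BlockChartSU N b)).withDensity fun z =>
        chartWeightSU b S (expJacWeightSU (kappaSU N)) z * K₀.indicator (fun w => ENNReal.ofReal (Real.exp (-A w))) z)
          (Env \ ({z | U z < θ} ∩ C))
      ≤ ENNReal.ofReal Q * ((volume : Measure (BlockChartSU N b)).withDensity fun z =>
        chartWeightSU b S (expJacWeightSU (kappaSU N)) z * K₀.indicator (fun w => ENNReal.ofReal (Real.exp (-A w))) z)
          ({z | U z < θ} ∩ C)) :
    SlotAntiConcentration (termFibreLawOfDatum₉ F N ϑ Dt g₀ os p g k t s b x) (blockReading N u b x) θ ρ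
      (3 * ((b.card : ℝ) * dimSU N + 1) * (1 + Q) / (κ₀ * (1 - ρ))) :=
  slotAC_termFibreLaw_of_chartAC F N ϑ Dt g₀ os p g k t s b x hS.le hSπ.le c hRm hlaw (measurable_blockReading hu b x)
    (chartAC_of_sect1Letters_dressed hN b hb hS hSπ c R u x K₀ A Qf lin Vt hAm hUm hC hEnv hθ hρ0 hρ1 hρσ hκ hQ0 hL hd hM hγ₀ hW
      hK₀ hA h0K₀ hexp h19 h16 hV hUL hUc hclause henv hRT hQ hR hread)

end End

end Summit.QuantumFields.YangMills.Theorems.N21LowCentreEndAtSUNBlockChartJacobianEnd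

end
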